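import Summits.HodgeConjecture.HodgeConjecture.Theorems.R90S6GSideEllipticValue              -- ★ G3 p864385: `orbitalIntegral_coeff_toVector_doubleCosetOperator_torusGen_pow` (ONE SHELL), adic pattern §2; brings ★ H2, ★ A1, ★ (J1)∕(J2)
import Summits.HodgeConjecture.HodgeConjecture.Theorems.R90S6EllipticOrbitalDisplacementCount   -- ★ A1: `finite_selfDual_displaced_of_finite_fixedPoints`, `setOf_selfDual_displaced_eq_setOf_displaced_type_zero`
import Summits.HodgeConjecture.HodgeConjecture.Theorems.R90S6TreeDisplacementSphereCount      -- ★ W8-f: `ncard_displaced_inter_type_eq_of_odd ∕ _of_even` (the two-type shell law)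
import Literature.NumberTheory.Automorphic.UnitaryLatticeTreeValencyInertPlace                -- ★ `finite_neighborSet_inert`, `ncard_neighborSet_eq_typeFun_inert` (`(q_v³+1, q_v+1)`-bi-regularity at an inert place)
import HarnessLib

/-!
# R90 · S6 — CARD G3-NUMBERS (row E1.3.5.2.6, G side): `O_{γ′}(Φ_m)` IN CLOSED FORM — the one-shell elliptic orbital integral on `U(2,1)_w` as an explicit power of `q_v`
# against the first-shell ∕ fixed-point data of `γ′` (`Theorems/R90S6GSideEllipticValueClosed.lean`)

Cell `hodgecm-mathlib`, crux H413 (`stmt-HodgeConjecture-24833`), route of record `HCCMUnconditional`; programme R90-TF, section S6 (base `R90-C14`), seat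
K2E3-p28 (g4) (E3 hand lent to S6 by the chair's across-lines valve; dealer R90-C14-plan (g2) CARD G3-NUMBERS, R90 bus 2026-09-05T02:04:17Z; heads note
R90-C14-p03 (g2) 02:03:39Z).  Helper lane `--supports stmt-HodgeConjecture-24833 --as helper`; THEOREMS ONLY (no definition, no instance, no notation, no named fact,
no `sorry`).  Architecture = the H-twin ★ `R90S6HSideEllipticValueClosed` (CARD H2-NUMBERS) layer by layer; imports ★ G3 `R90S6GSideEllipticValue`, ★ A1
`R90S6EllipticOrbitalDisplacementCount`, ★ W8-f `R90S6TreeDisplacementSphereCount`, ★ `UnitaryLatticeTreeValencyInertPlace` + HarnessLib.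

THE MATHEMATICS.  ★ G3 (one shell): `O_{γ′}^{ν∕t}(g ↦ (Φ_m [K₀])(gK₀)) = ν(K₀) · S′_m`, `S′_m := #{x ∈ X₃ : x hyperspecial ∧ d(x, γ′·x) = 2m}` (`Φ_m = T_{K₀ t^m K₀}`).
On the `(q³+1, q+1)`-BI-REGULAR tree of `U(2,1)_w` (type `0` = hyperspecial = self-dual, valency `q³ + 1`; type `1` = special non-hyperspecial, valency `q + 1`), for `γ′`
fixing a vertex with finite fixed set, ★ W8-f's two-type shell law (through ★ A1's type-zero bookkeeping) solves the hyperspecial displacement shells from the FIRST-SHELL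
DATA `N′_i := #{x : d(x, γ′x) = 2 ∧ type(x) = i}` and the FIXED count `F′₀ := #{x hyperspecial : γ′x = x}`:
**`S′_0 = F′₀`, `S′_{2n+1} = (q·q³)^n · N′₀ = q^{4n} · N′₀`, `S′_{2n+2} = q·(q³·q)^n · N′₁ = q^{4n+1} · N′₁`** — i.e. for `k ≥ 1`,
**`S′_k = q^{2k−3} · N′₁` (`k` even), `S′_k = q^{2(k−1)} · N′₀` (`k` odd)** (§1).  Hence (§2) **`O_{γ′}(Φ_m) = ν(K₀) · q^{2m−3} · N′₁` (`m ≥ 2` even), `= ν(K₀) · q^{2(m−1)} · N′₀`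
(`m` odd), `O_{γ′}(Φ_0) = ν(K₀) · F′₀`**; §3 is the inert-place edition at `E_w` with the local finiteness and the bi-regular valency `q = q_v := #(𝓞_F ∕ 𝔭_v)` DISCHARGED by
★ `finite_neighborSet_inert` ∕ ★ `ncard_neighborSet_eq_typeFun_inert`, preceded by the one-line bridge `Nat.sqrt #𝓀[E_w] = q_v` between ★ H2-NUMBERS' valency currency and this
file's.  Per γ′-type the data `(F′₀, N′₀, N′₁)` are read off `Fix(γ′)` (E1.3.5.2.6's sheet; not typed here);
CONSUMER BY NAME: the (E1) elliptic-identity sheet (these G-numbers against ★ H2-NUMBERS' H-numbers with the Flicker signs [BlasiusRogawski1992FL]).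
HONEST LABEL: arithmetic ∕ measure bookkeeping over ★ carriers (topological, Borel and Haar structures on `U(J₀,3)` are BINDERS as in ★ A1 ∕ ★ G3); proves no printed
global statement, discharges no citation; count-neutral helper until E1.3.5.2.6 consumes it.
HC_CM is proved only modulo the 7 printed citations (2 remaining named inputs: hLiu418 = stmt-HodgeConjecture-24832, h413 = stmt-HodgeConjecture-24833) until rung 0 closes; REL ≠ ★ ≠ BUILT.

## References
* [Rogawski1990] J. D. Rogawski, *Automorphic Representations of Unitary Groups in Three Variables*, Ann. of Math. Stud. 123 (1990): §4.9 pp. 54–56, §4.11 pp. 59–60.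
* [BlasiusRogawski1992FL] D. Blasius, J. D. Rogawski, *Fundamental lemmas for `U(3)` and related groups*, in: *The zeta functions of Picard modular surfaces* (1992): §§2–3.
* [Kottwitz1986BaseChangeUnits] R. E. Kottwitz, *Base change for unit elements of Hecke algebras*, Compositio Math. 60 (1986): §1 pp. 240–242, §3.
* [Serre1980Trees] J.-P. Serre, *Trees* (1980): I.2.3, I.6.4 Prop. 24–25, II.1.1.
* [Tits1979] J. Tits, *Reductive groups over local fields*, PSPM 33.1 (1979): §2.4 (quasi-split `U(3)`: local index `(q³+1, q+1)` at an inert place).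
-/

set_option autoImplicit false
-- the mandated namespace repeats the single-problem summit's segment (`HodgeConjecture.HodgeConjecture`)
set_option linter.dupNamespace false

noncomputable section

open MeasureTheory Measure Topology Set Function
open scoped ENNReal NNReal Pointwise Valued WithZero Matrix MatrixGroups
open MulAction SimpleGraph
open Literature.MeasureTheory.Group Literature.NumberTheory.Automorphic Literature.NumberTheory.Automorphic.heckeAlgebra
open Literature.NumberTheory.Automorphic.HermitianLattice Literature.NumberTheory.Automorphic.UnitaryLatticeTree
open Literature.Combinatorics.SimpleGraph

namespace Summit.HodgeConjecture.HodgeConjecture.R90.S6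

/-! ## §1 `U(2,1)`: the hyperspecial displacement shells against the first-shell data (`S′_0 = F′₀`, `S′_k = q^{2k−3} N′₁ ∕ q^{2(k−1)} N′₀`) -/

section Shells

variable {K : Type*} [Field K] [Valued K ℤᵐ⁰] {σ : K →+* K} {ϖ : K}

/-- **`S′_0 = F′₀`**: the hyperspecial vertices displaced by `0` are the hyperspecial FIXED vertices (the tree is connected, ★ `isTree_latticeGraph_three_of_unramified`).
[cite: Serre1980Trees, II.1.1] [cite: BruhatTits1972, §10] -/
theorem ncard_selfDual_displaced_zero_eq_ncard_fixed_three (hd : UnramifiedLocalConjDatum σ ϖ)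
    (γ : unitaryGroupOfForm σ ((StdForm.antidiagonal 3).over K)) :
    {x : {M : Submodule 𝒪[K] (Fin 3 → K) // IsVertex σ ϖ ((StdForm.antidiagonal 3).over K) M} |
        IsSelfDualLattice σ ϖ ((StdForm.antidiagonal 3).over K) x.1 ∧
          (latticeGraph σ ϖ ((StdForm.antidiagonal 3).over K)).dist x
            (latticeGraphPerm σ ϖ ((StdForm.antidiagonal 3).over K) γ x) = 2 * 0}.ncard =
      {x : {M : Submodule 𝒪[K] (Fin 3 → K) // IsVertex σ ϖ ((StdForm.antidiagonal 3).over K) M} |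
        IsSelfDualLattice σ ϖ ((StdForm.antidiagonal 3).over K) x.1 ∧
          latticeGraphIso σ ϖ ((StdForm.antidiagonal 3).over K) γ x = x}.ncard := by
  have hT := isTree_latticeGraph_three_of_unramified hd
  congr 1
  ext x
  simp only [Set.mem_setOf_eq, Nat.mul_zero, hT.connected.dist_eq_zero_iff]
  exact ⟨fun h => ⟨h.1, h.2.symm⟩, fun h => ⟨h.1, h.2.symm⟩⟩

/-- **`S′_k = q^{2k−3}·N′₁` (`k ≥ 2` even) ∕ `q^{2(k−1)}·N′₀` (`k` odd)** on the hyperspecial tree of `U(2,1)`: for `γ` fixing a vertex `u` with finite fixed set, the tree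
locally finite, a type function `c` (`c v = 0 ↔ v` self-dual) and every MOVED vertex `v` of valency `![q³, q] (c v) + 1` (the `(q³+1, q+1)`-bi-regularity [Tits1979]):
`#{x self-dual : d(x, γx) = 2k} = q^{2k−3}·#{x : d(x, γx) = 2 ∧ c x = 1}` if `k` is even and `= q^{2(k−1)}·#{x : d(x, γx) = 2 ∧ c x = 0}` if `k` is odd — ★ W8-f
`ncard_displaced_inter_type_eq_of_even ∕ _of_odd` at `q₀ = q³`, `q₁ = q` (`q·(q³·q)^n = q^{4n+1}`, `(q·q³)^n = q^{4n}`) through ★ A1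
`setOf_selfDual_displaced_eq_setOf_displaced_type_zero` and ★ `typeFun_ne_of_adj`. [cite: Serre1980Trees, I.2.3, I.6.4 Prop. 24] [cite: Tits1979, §2.4] [cite: BlasiusRogawski1992FL, §§2–3] -/
theorem ncard_selfDual_displaced_eq_pow_mul_firstShell_three (hd : UnramifiedLocalConjDatum σ ϖ)
    (γ : unitaryGroupOfForm σ ((StdForm.antidiagonal 3).over K))
    (hloc : ∀ v, ((latticeGraph σ ϖ ((StdForm.antidiagonal 3).over K)).neighborSet v).Finite)
    {u : {M : Submodule 𝒪[K] (Fin 3 → K) // IsVertex σ ϖ ((StdForm.antidiagonal 3).over K) M}}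
    (hu : latticeGraphIso σ ϖ ((StdForm.antidiagonal 3).over K) γ u = u)
    (hfix : {v | latticeGraphIso σ ϖ ((StdForm.antidiagonal 3).over K) γ v = v}.Finite)
    (c : {M : Submodule 𝒪[K] (Fin 3 → K) // IsVertex σ ϖ ((StdForm.antidiagonal 3).over K) M} → Fin 2)
    (hc0 : ∀ v, c v = 0 ↔ IsSelfDualLattice σ ϖ ((StdForm.antidiagonal 3).over K) v.1) (q : ℕ)
    (hdeg : ∀ v, latticeGraphIso σ ϖ ((StdForm.antidiagonal 3).over K) γ v ≠ v →
      ((latticeGraph σ ϖ ((StdForm.antidiagonal 3).over K)).neighborSet v).ncard = (![q ^ 3, q] : Fin 2 → ℕ) (c v) + 1)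
    (k : ℕ) (hk : 1 ≤ k) :
    {x : {M : Submodule 𝒪[K] (Fin 3 → K) // IsVertex σ ϖ ((StdForm.antidiagonal 3).over K) M} |
        IsSelfDualLattice σ ϖ ((StdForm.antidiagonal 3).over K) x.1 ∧
          (latticeGraph σ ϖ ((StdForm.antidiagonal 3).over K)).dist x
            (latticeGraphPerm σ ϖ ((StdForm.antidiagonal 3).over K) γ x) = 2 * k}.ncard =
      if Even k then
        q ^ (2 * k - 3) *
          {x | (latticeGraph σ ϖ ((StdForm.antidiagonal 3).over K)).dist x (latticeGraphIso σ ϖ ((StdForm.antidiagonal 3).over K) γ x) = 2 ∧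
            c x = 1}.ncard
      else
        q ^ (2 * (k - 1)) *
          {x | (latticeGraph σ ϖ ((StdForm.antidiagonal 3).over K)).dist x (latticeGraphIso σ ϖ ((StdForm.antidiagonal 3).over K) γ x) = 2 ∧
            c x = 0}.ncard := by
  classical
  have hT := isTree_latticeGraph_three_of_unramified hd
  haveI : (latticeGraph σ ϖ ((StdForm.antidiagonal 3).over K)).LocallyFinite := fun v => (hloc v).fintype
  have hdeg' : ∀ v, latticeGraphIso σ ϖ ((StdForm.antidiagonal 3).over K) γ v ≠ v →
      (latticeGraph σ ϖ ((StdForm.antidiagonal 3).over K)).degree v = (![q ^ 3, q] : Fin 2 → ℕ) (c v) + 1 := fun v hv => by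
    rw [TreeDisplacement.degree_eq_ncard_neighborSet]; exact hdeg v hv
  rw [setOf_selfDual_displaced_eq_setOf_displaced_type_zero γ c hc0]
  rcases Nat.even_or_odd' k with ⟨n, hn | hn⟩
  · -- `k = 2n`, `n = n' + 1`, `k = 2n' + 2`: the even shells descend to the SPECIAL first shell `N′₁`
    obtain ⟨n', rfl⟩ := Nat.exists_eq_succ_of_ne_zero (show n ≠ 0 by omega)
    have hke : Even k := ⟨n' + 1, by omega⟩
    have hk2 : k = 2 * n' + 2 := by omega
    rw [if_pos hke, hk2, ncard_displaced_inter_type_eq_of_even hT (latticeGraphIso σ ϖ ((StdForm.antidiagonal 3).over K) γ) hu hfix c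
      (typeFun_ne_of_adj hd hc0) (![q ^ 3, q] : Fin 2 → ℕ) hdeg' Fin.zero_ne_one n', show 2 * (2 * n' + 2) - 3 = 4 * n' + 1 by omega]
    simp only [Matrix.cons_val_zero, Matrix.cons_val_one]
    ring
  · -- `k = 2n + 1`: the odd shells descend to the HYPERSPECIAL first shell `N′₀`
    have hko : ¬ Even k := by rw [hn, Nat.even_add_one]; exact not_not.mpr (even_two_mul n)
    rw [if_neg hko, hn, ncard_displaced_inter_type_eq_of_odd hT (latticeGraphIso σ ϖ ((StdForm.antidiagonal 3).over K) γ) hu hfix c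
      (typeFun_ne_of_adj hd hc0) (![q ^ 3, q] : Fin 2 → ℕ) hdeg' Fin.zero_ne_one n, show 2 * (2 * n + 1 - 1) = 4 * n by omega]
    simp only [Matrix.cons_val_zero, Matrix.cons_val_one]
    ring

end Shells

/-! ## §2 `U(2,1)`: the one-shell orbital integral `O_γ(Φ_m)` in closed form -/

section Unitary

variable {K : Type*} [Field K] [Valued K ℤᵐ⁰] {σ : K →+* K} {ϖ : K}
  (hd : UnramifiedLocalConjDatum σ ϖ)
  [IsHeckeTriple (⊤ : Submonoid (unitaryGroupOfForm σ ((StdForm.antidiagonal 3).over K)))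
    (unitaryInt σ ((StdForm.antidiagonal 3).over K)) (unitaryInt σ ((StdForm.antidiagonal 3).over K))]
  [LocallyCompactSpace (unitaryGroupOfForm σ ((StdForm.antidiagonal 3).over K))]
  [SecondCountableTopology (unitaryGroupOfForm σ ((StdForm.antidiagonal 3).over K))]
  [MeasurableSpace (unitaryGroupOfForm σ ((StdForm.antidiagonal 3).over K))] [BorelSpace (unitaryGroupOfForm σ ((StdForm.antidiagonal 3).over K))]
  (γ : unitaryGroupOfForm σ ((StdForm.antidiagonal 3).over K))
  [MeasurableSpace (unitaryGroupOfForm σ ((StdForm.antidiagonal 3).over K) ⧸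
    Subgroup.centralizer ({γ} : Set (unitaryGroupOfForm σ ((StdForm.antidiagonal 3).over K))))]
  [BorelSpace (unitaryGroupOfForm σ ((StdForm.antidiagonal 3).over K) ⧸
    Subgroup.centralizer ({γ} : Set (unitaryGroupOfForm σ ((StdForm.antidiagonal 3).over K))))]
  [hC : IsClosed ((Subgroup.centralizer ({γ} : Set (unitaryGroupOfForm σ ((StdForm.antidiagonal 3).over K))) :
    Subgroup (unitaryGroupOfForm σ ((StdForm.antidiagonal 3).over K))) : Set (unitaryGroupOfForm σ ((StdForm.antidiagonal 3).over K)))]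
  (t : Measure (Subgroup.centralizer ({γ} : Set (unitaryGroupOfForm σ ((StdForm.antidiagonal 3).over K)))))
  [t.IsMulLeftInvariant] [IsFiniteMeasureOnCompacts t] [t.IsOpenPosMeasure] [t.IsInvInvariant] [SFinite t]
  (ν : Measure (unitaryGroupOfForm σ ((StdForm.antidiagonal 3).over K))) [IsHaarMeasure ν] [ν.IsMulRightInvariant]
  [CompactSpace (Subgroup.centralizer ({γ} : Set (unitaryGroupOfForm σ ((StdForm.antidiagonal 3).over K))))]
  (ht : t Set.univ = 1)
include ht

/-- **`U(2,1)` — `O_γ(Φ_m)` IN CLOSED FORM, `m ≥ 1`** (`Φ_m = T_{K₀ tᵐ K₀}`, `t = hd.torusGen`; `γ` with COMPACT centraliser of mass-one `t` fixing a vertex `u`, finite fixed set,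
locally finite tree, type function `c`, every moved vertex of valency `![q³, q] (c v) + 1`, `ν` Haar):
`O_γ^{ν∕t}(g ↦ (Φ_m [K₀])(gK₀)) = ν(K₀) · (q^{2m−3}·N′₁ if m even, q^{2(m−1)}·N′₀ if m odd)`, `N′_i = #{x : d(x, γx) = 2 ∧ c x = i}` — ★ G3
`orbitalIntegral_coeff_toVector_doubleCosetOperator_torusGen_pow` (finiteness ★ A1 `finite_selfDual_displaced_of_finite_fixedPoints`) rewritten by §1.
[cite: Rogawski1990, §4.9 pp. 54–55] [cite: Kottwitz1986BaseChangeUnits, §1 pp. 240–242] [cite: BlasiusRogawski1992FL, §§2–3] [cite: Serre1980Trees, I.6.4 Prop. 24] -/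
theorem orbitalIntegral_coeff_toVector_doubleCosetOperator_torusGen_pow_eq_closed_three
    (hloc : ∀ v, ((latticeGraph σ ϖ ((StdForm.antidiagonal 3).over K)).neighborSet v).Finite)
    {u : {M : Submodule 𝒪[K] (Fin 3 → K) // IsVertex σ ϖ ((StdForm.antidiagonal 3).over K) M}}
    (hu : latticeGraphIso σ ϖ ((StdForm.antidiagonal 3).over K) γ u = u)
    (hfix : {v | latticeGraphIso σ ϖ ((StdForm.antidiagonal 3).over K) γ v = v}.Finite)
    (c : {M : Submodule 𝒪[K] (Fin 3 → K) // IsVertex σ ϖ ((StdForm.antidiagonal 3).over K) M} → Fin 2)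
    (hc0 : ∀ v, c v = 0 ↔ IsSelfDualLattice σ ϖ ((StdForm.antidiagonal 3).over K) v.1) (q : ℕ)
    (hdeg : ∀ v, latticeGraphIso σ ϖ ((StdForm.antidiagonal 3).over K) γ v ≠ v →
      ((latticeGraph σ ϖ ((StdForm.antidiagonal 3).over K)).neighborSet v).ncard = (![q ^ 3, q] : Fin 2 → ℕ) (c v) + 1)
    (m : ℕ) (hm : 1 ≤ m) :
    orbitalIntegral γ (fun x : unitaryGroupOfForm σ ((StdForm.antidiagonal 3).over K) =>
        (toVector (unitaryInt σ ((StdForm.antidiagonal 3).over K))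
          (doubleCosetOperator (k := ℂ) (unitaryInt σ ((StdForm.antidiagonal 3).over K)) (hd.torusGen ^ m))).coeff
          (x : unitaryGroupOfForm σ ((StdForm.antidiagonal 3).over K) ⧸ unitaryInt σ ((StdForm.antidiagonal 3).over K)))
        (quotientMeasure (Subgroup.centralizer ({γ} : Set (unitaryGroupOfForm σ ((StdForm.antidiagonal 3).over K)))) t hC ν) =
      (ν (unitaryInt σ ((StdForm.antidiagonal 3).over K))).toReal *
        (if Even m then
          (q : ℂ) ^ (2 * m - 3) *
            ({x : {M : Submodule 𝒪[K] (Fin 3 → K) // IsVertex σ ϖ ((StdForm.antidiagonal 3).over K) M} |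
                (latticeGraph σ ϖ ((StdForm.antidiagonal 3).over K)).dist x (latticeGraphIso σ ϖ ((StdForm.antidiagonal 3).over K) γ x) = 2 ∧
                  c x = 1}.ncard : ℂ)
        else
          (q : ℂ) ^ (2 * (m - 1)) *
            ({x : {M : Submodule 𝒪[K] (Fin 3 → K) // IsVertex σ ϖ ((StdForm.antidiagonal 3).over K) M} |
                (latticeGraph σ ϖ ((StdForm.antidiagonal 3).over K)).dist x (latticeGraphIso σ ϖ ((StdForm.antidiagonal 3).over K) γ x) = 2 ∧
                  c x = 0}.ncard : ℂ)) := by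
  rw [orbitalIntegral_coeff_toVector_doubleCosetOperator_torusGen_pow hd γ t ν ht m (finite_selfDual_displaced_of_finite_fixedPoints hd γ hloc hu hfix m),
    ncard_selfDual_displaced_eq_pow_mul_firstShell_three hd γ hloc hu hfix c hc0 q hdeg m hm]
  split_ifs <;> push_cast <;> ring

/-- **`U(2,1)` — `O_γ(Φ_0) = ν(K₀) · F′₀`** (`Φ_0 = T_{K₀ t⁰ K₀} = 𝟙_{K₀}`; `F′₀ = #{x hyperspecial : γx = x}`; `γ` with COMPACT centraliser of mass-one `t` fixing a vertex `u`, finite fixed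
set, locally finite tree): ★ G3's one-shell theorem at `m = 0` rewritten by §1 `ncard_selfDual_displaced_zero_eq_ncard_fixed_three`.
[cite: Rogawski1990, §4.9 pp. 54–55] [cite: Kottwitz1986BaseChangeUnits, §1 pp. 240–242] [cite: Serre1980Trees, II.1.1] -/
theorem orbitalIntegral_coeff_toVector_doubleCosetOperator_torusGen_pow_zero_eq_three
    (hloc : ∀ v, ((latticeGraph σ ϖ ((StdForm.antidiagonal 3).over K)).neighborSet v).Finite)
    {u : {M : Submodule 𝒪[K] (Fin 3 → K) // IsVertex σ ϖ ((StdForm.antidiagonal 3).over K) M}}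
    (hu : latticeGraphIso σ ϖ ((StdForm.antidiagonal 3).over K) γ u = u)
    (hfix : {v | latticeGraphIso σ ϖ ((StdForm.antidiagonal 3).over K) γ v = v}.Finite) :
    orbitalIntegral γ (fun x : unitaryGroupOfForm σ ((StdForm.antidiagonal 3).over K) =>
        (toVector (unitaryInt σ ((StdForm.antidiagonal 3).over K))
          (doubleCosetOperator (k := ℂ) (unitaryInt σ ((StdForm.antidiagonal 3).over K)) (hd.torusGen ^ 0))).coeff
          (x : unitaryGroupOfForm σ ((StdForm.antidiagonal 3).over K) ⧸ unitaryInt σ ((StdForm.antidiagonal 3).over K)))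
        (quotientMeasure (Subgroup.centralizer ({γ} : Set (unitaryGroupOfForm σ ((StdForm.antidiagonal 3).over K)))) t hC ν) =
      (ν (unitaryInt σ ((StdForm.antidiagonal 3).over K))).toReal *
        ({x : {M : Submodule 𝒪[K] (Fin 3 → K) // IsVertex σ ϖ ((StdForm.antidiagonal 3).over K) M} |
            IsSelfDualLattice σ ϖ ((StdForm.antidiagonal 3).over K) x.1 ∧
              latticeGraphIso σ ϖ ((StdForm.antidiagonal 3).over K) γ x = x}.ncard : ℂ) := by
  rw [orbitalIntegral_coeff_toVector_doubleCosetOperator_torusGen_pow hd γ t ν ht 0 (finite_selfDual_displaced_of_finite_fixedPoints hd γ hloc hu hfix 0),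
    ncard_selfDual_displaced_zero_eq_ncard_fixed_three hd γ]

end Unitary

/-! ## §3 The inert-place edition on `U(2,1)_w = U(J₀,3)(E_w)`: `q = q_v = #(𝓞_F ∕ 𝔭_v)`, local finiteness and bi-regularity DISCHARGED -/

section Bridge

open NumberField IsDedekindDomain Literature.NumberTheory.Automorphic.UnitaryGroup

variable {F E : Type} [Field F] [NumberField F] [Field E] [NumberField E] [Algebra F E] [Algebra.IsQuadraticExtension F E]
  (c : E ≃ₐ[F] E) (v : HeightOneSpectrum (𝓞 F))

/-- **THE TWO `q`-CURRENCIES AGREE at an inert unramified place**: `Nat.sqrt #𝓀[E_w] = q_v = #(𝓞_F ∕ 𝔭_v)` — ★ H2-NUMBERS feeds its valency binder with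
`Nat.sqrt (Nat.card 𝓀[E_w])`, §3 below discharges it in `Nat.card (𝓞 F ⧸ v.asIdeal)`; the (E1) sheet rewrites either with this line (★ `fintypeCard_valuedResidueField_eq_sq_of_inert`
+ `Nat.sqrt_eq'`). [cite: Tits1979, §2.4] [cite: Serre1980Trees, II.1.1] -/
theorem natSqrt_natCard_residueField_adicCompletion_eq_of_inert (hc1 : c ≠ 1) (hv : Algebra.IsUnramifiedIn (𝓞 E) v.asIdeal)
    (w : PlacesOver E v) (hw : c • w.1 = w.1) :
    Nat.sqrt (Nat.card (Valued.ResidueField (w.1.adicCompletion E))) = Nat.card (𝓞 F ⧸ v.asIdeal) := by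
  letI : Fintype (Valued.ResidueField (w.1.adicCompletion E)) := Fintype.ofFinite _
  rw [Nat.card_eq_fintype_card, fintypeCard_valuedResidueField_eq_sq_of_inert c v hc1 hv w hw, Nat.sqrt_eq']

end Bridge

section Adic

open NumberField IsDedekindDomain Literature.NumberTheory.Automorphic.UnitaryGroup

variable {F E : Type} [Field F] [NumberField F] [Field E] [NumberField E] [Algebra F E] [Algebra.IsQuadraticExtension F E]
  (c : E ≃ₐ[F] E) (hc1 : c ≠ 1) (v : HeightOneSpectrum (𝓞 F)) (w : PlacesOver E v) (hw : c • w.1 = w.1)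
  (hv : Algebra.IsUnramifiedIn (𝓞 E) v.asIdeal)
  [LocallyCompactSpace (unitaryGroupOfForm (galAdicCompletionMap (L := E) c hw) ((StdForm.antidiagonal 3).over (w.1.adicCompletion E)))]
  [SecondCountableTopology (unitaryGroupOfForm (galAdicCompletionMap (L := E) c hw) ((StdForm.antidiagonal 3).over (w.1.adicCompletion E)))]
  [MeasurableSpace (unitaryGroupOfForm (galAdicCompletionMap (L := E) c hw) ((StdForm.antidiagonal 3).over (w.1.adicCompletion E)))]
  [BorelSpace (unitaryGroupOfForm (galAdicCompletionMap (L := E) c hw) ((StdForm.antidiagonal 3).over (w.1.adicCompletion E)))]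
  (γ : unitaryGroupOfForm (galAdicCompletionMap (L := E) c hw) ((StdForm.antidiagonal 3).over (w.1.adicCompletion E)))
  [MeasurableSpace (unitaryGroupOfForm (galAdicCompletionMap (L := E) c hw) ((StdForm.antidiagonal 3).over (w.1.adicCompletion E)) ⧸
    Subgroup.centralizer ({γ} : Set (unitaryGroupOfForm (galAdicCompletionMap (L := E) c hw) ((StdForm.antidiagonal 3).over (w.1.adicCompletion E)))))]
  [BorelSpace (unitaryGroupOfForm (galAdicCompletionMap (L := E) c hw) ((StdForm.antidiagonal 3).over (w.1.adicCompletion E)) ⧸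
    Subgroup.centralizer ({γ} : Set (unitaryGroupOfForm (galAdicCompletionMap (L := E) c hw) ((StdForm.antidiagonal 3).over (w.1.adicCompletion E)))))]
  [hC : IsClosed ((Subgroup.centralizer ({γ} : Set (unitaryGroupOfForm (galAdicCompletionMap (L := E) c hw) ((StdForm.antidiagonal 3).over (w.1.adicCompletion E)))) :
    Subgroup (unitaryGroupOfForm (galAdicCompletionMap (L := E) c hw) ((StdForm.antidiagonal 3).over (w.1.adicCompletion E)))) :
      Set (unitaryGroupOfForm (galAdicCompletionMap (L := E) c hw) ((StdForm.antidiagonal 3).over (w.1.adicCompletion E))))]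
  (t : Measure (Subgroup.centralizer ({γ} : Set (unitaryGroupOfForm (galAdicCompletionMap (L := E) c hw) ((StdForm.antidiagonal 3).over (w.1.adicCompletion E))))))
  [t.IsMulLeftInvariant] [IsFiniteMeasureOnCompacts t] [t.IsOpenPosMeasure] [t.IsInvInvariant] [SFinite t]
  (ν : Measure (unitaryGroupOfForm (galAdicCompletionMap (L := E) c hw) ((StdForm.antidiagonal 3).over (w.1.adicCompletion E))))
  [IsHaarMeasure ν] [ν.IsMulRightInvariant]
  [CompactSpace (Subgroup.centralizer ({γ} : Set (unitaryGroupOfForm (galAdicCompletionMap (L := E) c hw) ((StdForm.antidiagonal 3).over (w.1.adicCompletion E)))))]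
  (ht : t Set.univ = 1)
include ht

/-- **CARD G3-NUMBERS — `O_γ(Φ_m)` IN CLOSED FORM at an inert unramified place `w ∣ v`, `m ≥ 1`** (`Φ_m = T_{K₀ t_wᵐ K₀}`, `t_w = hd_w.torusGen`,
`hd_w = unramifiedLocalConjDatum_localConjUniformizer …`; `γ ∈ U(J₀,3)(E_w)` with COMPACT centraliser of mass-one `t` fixing a vertex `u` of `X₃(E_w)`, finite fixed set;
type function `cty`; `q_v = #(𝓞_F ∕ 𝔭_v)`):  `O_γ^{ν∕t}(g ↦ (Φ_m [K₀])(gK₀)) = ν(K₀) · (q_v^{2m−3}·N′₁ if m even, q_v^{2(m−1)}·N′₀ if m odd)` — §2 with the tree's local finiteness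
★ `finite_neighborSet_inert` and its `(q_v³+1, q_v+1)`-bi-regularity ★ `ncard_neighborSet_eq_typeFun_inert` DISCHARGED (`K₀` compact ★ `isCompact_unitaryInt_adicCompletion`, Hecke
pair ★ `isHeckeTriple_unitaryInt_adicCompletion`).  `m = 1`: `ν(K₀)·N′₀`; `m = 2`: `ν(K₀)·q_v·N′₁`; `m = 3`: `ν(K₀)·q_v⁴·N′₀`.
[cite: Rogawski1990, §4.9 Prop. 4.9.1, pp. 54–56] [cite: BlasiusRogawski1992FL, §§2–3] [cite: Tits1979, §2.4] [cite: Kottwitz1986BaseChangeUnits, §1 pp. 240–242] -/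
theorem orbitalIntegral_coeff_toVector_doubleCosetOperator_torusGen_pow_eq_closed_adic
    {u : {M : Submodule 𝒪[w.1.adicCompletion E] (Fin 3 → w.1.adicCompletion E) //
      IsVertex (galAdicCompletionMap (L := E) c hw) (localConjUniformizer c hc1 v w hw hv) ((StdForm.antidiagonal 3).over (w.1.adicCompletion E)) M}}
    (hu : latticeGraphIso (galAdicCompletionMap (L := E) c hw) (localConjUniformizer c hc1 v w hw hv) ((StdForm.antidiagonal 3).over (w.1.adicCompletion E)) γ u = u)
    (hfix : {x | latticeGraphIso (galAdicCompletionMap (L := E) c hw) (localConjUniformizer c hc1 v w hw hv)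
      ((StdForm.antidiagonal 3).over (w.1.adicCompletion E)) γ x = x}.Finite)
    (cty : {M : Submodule 𝒪[w.1.adicCompletion E] (Fin 3 → w.1.adicCompletion E) //
      IsVertex (galAdicCompletionMap (L := E) c hw) (localConjUniformizer c hc1 v w hw hv) ((StdForm.antidiagonal 3).over (w.1.adicCompletion E)) M} → Fin 2)
    (hc0 : ∀ x, cty x = 0 ↔
      IsSelfDualLattice (galAdicCompletionMap (L := E) c hw) (localConjUniformizer c hc1 v w hw hv) ((StdForm.antidiagonal 3).over (w.1.adicCompletion E)) x.1)
    (m : ℕ) (hm : 1 ≤ m) :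
    haveI := isHeckeTriple_unitaryInt_adicCompletion c v w hw ((StdForm.antidiagonal 3).over (w.1.adicCompletion E))
    orbitalIntegral γ
        (fun x : unitaryGroupOfForm (galAdicCompletionMap (L := E) c hw) ((StdForm.antidiagonal 3).over (w.1.adicCompletion E)) =>
          (toVector (unitaryInt (galAdicCompletionMap (L := E) c hw) ((StdForm.antidiagonal 3).over (w.1.adicCompletion E)))
            (doubleCosetOperator (k := ℂ) (unitaryInt (galAdicCompletionMap (L := E) c hw) ((StdForm.antidiagonal 3).over (w.1.adicCompletion E)))
              ((unramifiedLocalConjDatum_localConjUniformizer c hc1 v w hw hv).torusGen ^ m))).coeff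
            (x : unitaryGroupOfForm (galAdicCompletionMap (L := E) c hw) ((StdForm.antidiagonal 3).over (w.1.adicCompletion E)) ⧸
              unitaryInt (galAdicCompletionMap (L := E) c hw) ((StdForm.antidiagonal 3).over (w.1.adicCompletion E))))
        (quotientMeasure (Subgroup.centralizer ({γ} : Set (unitaryGroupOfForm (galAdicCompletionMap (L := E) c hw)
          ((StdForm.antidiagonal 3).over (w.1.adicCompletion E))))) t hC ν) =
      (ν (unitaryInt (galAdicCompletionMap (L := E) c hw) ((StdForm.antidiagonal 3).over (w.1.adicCompletion E)))).toReal *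
        (if Even m then
          ((Nat.card (𝓞 F ⧸ v.asIdeal) : ℕ) : ℂ) ^ (2 * m - 3) *
            ({x : {M : Submodule 𝒪[w.1.adicCompletion E] (Fin 3 → w.1.adicCompletion E) //
                IsVertex (galAdicCompletionMap (L := E) c hw) (localConjUniformizer c hc1 v w hw hv) ((StdForm.antidiagonal 3).over (w.1.adicCompletion E)) M} |
                (latticeGraph (galAdicCompletionMap (L := E) c hw) (localConjUniformizer c hc1 v w hw hv)
                    ((StdForm.antidiagonal 3).over (w.1.adicCompletion E))).dist x
                  (latticeGraphIso (galAdicCompletionMap (L := E) c hw) (localConjUniformizer c hc1 v w hw hv)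
                    ((StdForm.antidiagonal 3).over (w.1.adicCompletion E)) γ x) = 2 ∧ cty x = 1}.ncard : ℂ)
        else
          ((Nat.card (𝓞 F ⧸ v.asIdeal) : ℕ) : ℂ) ^ (2 * (m - 1)) *
            ({x : {M : Submodule 𝒪[w.1.adicCompletion E] (Fin 3 → w.1.adicCompletion E) //
                IsVertex (galAdicCompletionMap (L := E) c hw) (localConjUniformizer c hc1 v w hw hv) ((StdForm.antidiagonal 3).over (w.1.adicCompletion E)) M} |
                (latticeGraph (galAdicCompletionMap (L := E) c hw) (localConjUniformizer c hc1 v w hw hv)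
                    ((StdForm.antidiagonal 3).over (w.1.adicCompletion E))).dist x
                  (latticeGraphIso (galAdicCompletionMap (L := E) c hw) (localConjUniformizer c hc1 v w hw hv)
                    ((StdForm.antidiagonal 3).over (w.1.adicCompletion E)) γ x) = 2 ∧ cty x = 0}.ncard : ℂ)) := by
  haveI := isHeckeTriple_unitaryInt_adicCompletion c v w hw ((StdForm.antidiagonal 3).over (w.1.adicCompletion E))
  exact orbitalIntegral_coeff_toVector_doubleCosetOperator_torusGen_pow_eq_closed_three (unramifiedLocalConjDatum_localConjUniformizer c hc1 v w hw hv)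
    γ t ν ht (finite_neighborSet_inert c v w hw (unramifiedLocalConjDatum_localConjUniformizer c hc1 v w hw hv)) hu hfix cty hc0
    (Nat.card (𝓞 F ⧸ v.asIdeal))
    (fun x _ => ncard_neighborSet_eq_typeFun_inert c v hc1 hv w hw (unramifiedLocalConjDatum_localConjUniformizer c hc1 v w hw hv) hc0 x) m hm

/-- **CARD G3-NUMBERS, `m = 0` at an inert unramified place — `O_γ(Φ_0) = ν(K₀) · F′₀`** (`Φ_0 = 𝟙_{K₀}`, `F′₀ = #{x ∈ X₃(E_w) hyperspecial : γx = x}`; `γ` with COMPACT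
centraliser of mass-one `t` fixing a vertex `u`, finite fixed set): §2 with ★ `finite_neighborSet_inert`. [cite: Rogawski1990, §4.9 pp. 54–55] [cite: Kottwitz1986BaseChangeUnits, §1 pp. 240–242] -/
theorem orbitalIntegral_coeff_toVector_doubleCosetOperator_torusGen_pow_zero_eq_adic
    {u : {M : Submodule 𝒪[w.1.adicCompletion E] (Fin 3 → w.1.adicCompletion E) //
      IsVertex (galAdicCompletionMap (L := E) c hw) (localConjUniformizer c hc1 v w hw hv) ((StdForm.antidiagonal 3).over (w.1.adicCompletion E)) M}}
    (hu : latticeGraphIso (galAdicCompletionMap (L := E) c hw) (localConjUniformizer c hc1 v w hw hv) ((StdForm.antidiagonal 3).over (w.1.adicCompletion E)) γ u = u)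
    (hfix : {x | latticeGraphIso (galAdicCompletionMap (L := E) c hw) (localConjUniformizer c hc1 v w hw hv)
      ((StdForm.antidiagonal 3).over (w.1.adicCompletion E)) γ x = x}.Finite) :
    haveI := isHeckeTriple_unitaryInt_adicCompletion c v w hw ((StdForm.antidiagonal 3).over (w.1.adicCompletion E))
    orbitalIntegral γ
        (fun x : unitaryGroupOfForm (galAdicCompletionMap (L := E) c hw) ((StdForm.antidiagonal 3).over (w.1.adicCompletion E)) =>
          (toVector (unitaryInt (galAdicCompletionMap (L := E) c hw) ((StdForm.antidiagonal 3).over (w.1.adicCompletion E)))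
            (doubleCosetOperator (k := ℂ) (unitaryInt (galAdicCompletionMap (L := E) c hw) ((StdForm.antidiagonal 3).over (w.1.adicCompletion E)))
              ((unramifiedLocalConjDatum_localConjUniformizer c hc1 v w hw hv).torusGen ^ 0))).coeff
            (x : unitaryGroupOfForm (galAdicCompletionMap (L := E) c hw) ((StdForm.antidiagonal 3).over (w.1.adicCompletion E)) ⧸
              unitaryInt (galAdicCompletionMap (L := E) c hw) ((StdForm.antidiagonal 3).over (w.1.adicCompletion E))))
        (quotientMeasure (Subgroup.centralizer ({γ} : Set (unitaryGroupOfForm (galAdicCompletionMap (L := E) c hw)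
          ((StdForm.antidiagonal 3).over (w.1.adicCompletion E))))) t hC ν) =
      (ν (unitaryInt (galAdicCompletionMap (L := E) c hw) ((StdForm.antidiagonal 3).over (w.1.adicCompletion E)))).toReal *
        ({x : {M : Submodule 𝒪[w.1.adicCompletion E] (Fin 3 → w.1.adicCompletion E) //
            IsVertex (galAdicCompletionMap (L := E) c hw) (localConjUniformizer c hc1 v w hw hv) ((StdForm.antidiagonal 3).over (w.1.adicCompletion E)) M} |
            IsSelfDualLattice (galAdicCompletionMap (L := E) c hw) (localConjUniformizer c hc1 v w hw hv) ((StdForm.antidiagonal 3).over (w.1.adicCompletion E)) x.1 ∧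
              latticeGraphIso (galAdicCompletionMap (L := E) c hw) (localConjUniformizer c hc1 v w hw hv)
                ((StdForm.antidiagonal 3).over (w.1.adicCompletion E)) γ x = x}.ncard : ℂ) := by
  haveI := isHeckeTriple_unitaryInt_adicCompletion c v w hw ((StdForm.antidiagonal 3).over (w.1.adicCompletion E))
  exact orbitalIntegral_coeff_toVector_doubleCosetOperator_torusGen_pow_zero_eq_three (unramifiedLocalConjDatum_localConjUniformizer c hc1 v w hw hv)
    γ t ν ht (finite_neighborSet_inert c v w hw (unramifiedLocalConjDatum_localConjUniformizer c hc1 v w hw hv)) hu hfix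

end Adic

end Summit.HodgeConjecture.HodgeConjecture.R90.S6

end
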